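import Summits.AtomisticToContinuum.HydrodynamicLimit.Theses.JParityClosure
import Literature.MathematicalPhysics.KineticTheory.EvenCollisionTubeFunctional
import Literature.MathematicalPhysics.KineticTheory.MicroscaleWindowFunctionals
import HarnessLib

/-!
# The pre-shock contact side from the pre-shock crux and the pre-shock Enskog side
# (line `preshock-kinetic-slaving`, crux `JParityClosure.EvenStressEnskog`, stmt-AtomisticToContinuum-13079 — lead c7)

Definition-free companion of the pre-shock glue of the line.  The planners' recommended restatement R of the crux is its
pre-shock, LLN-tied form `EvenStressEnskogPreShock` (lead c6 `Cruxes/EvenStressEnskog/RestatePreShock.lean`; strategist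
`STRATEGY-CENSUS.md`), to be split as `EvenStressEnskogPreShock ⇐ ContactEvenPreShock ∧ VelocityEquilibrationPreShock`.
This file records the CONVERSE direction of that split in the two-body slot:

* `contactEvenPreShock_of_evenStressEnskogPreShock_of_enskogSidePreShock` — the restated crux (`evenStat` small in
  probability, pre-shock frame) AND the pre-shock Enskog side (`contactPredM ≈ σ³∫₀^τ enskogRate`, which the line derives
  from the one-body statement (L1) by an exact identity) give the pre-shock CONTACT side (`collisionSum ≈ contactPredM`
  for the six even marks): union bound `{η < |K − C|} ⊆ {η/2 < |K − E|} ∪ {η/2 < |C − E|}` pair by pair — verbatim the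
  landed ∀τ version `contactSide_of_evenStressEnskog_of_enskogSide` (p134979) re-threaded with the binders
  `T ρ θ u, hEuler, Φ, hLLN, τ, hτ, hτT`.

Consequence for the planner: modulo the kinetic half (which yields the Enskog side), the crux child `ContactEvenPreShock`
of the split is EQUIVALENT to the restated crux — the split loses nothing.  All statements are spelled out (a Theorems
file imports no `Lines/` file and defines no `Prop`).  References: Chapman–Cowling (1970) Ch. 16; Spohn (1991) Part I
§3.2; van Beijeren–Ernst (1973).
-/

noncomputable section

namespace Summit.AtomisticToContinuum.HydrodynamicLimit.Theorems.EvenStressEnskog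

open scoped BigOperators InnerProductSpace Topology ENNReal
open MeasureTheory Filter Set
open Literature.MathematicalPhysics.KineticTheory Literature.Analysis.FluidPDE
open Literature.MathematicalPhysics.KineticTheory.StationaryMicroscale
open Summit.AtomisticToContinuum.HydrodynamicLimit.Theses.JParityClosure

/-- **PRE-SHOCK CRUX + PRE-SHOCK ENSKOG SIDE ⇒ PRE-SHOCK CONTACT SIDE.**  First hypothesis: the body of
`EvenStressEnskogPreShock` (the crux restated in the pre-shock, LLN-tied frame of the sibling `OddContactSymmetry`: for
`σ < σ₀`, every classical hs-Euler solution on `[0,T)`, every flow family with the `t = 0` LLN towards it and every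
`0 < τ < T`, `evenStat = collisionSum − σ³∫₀^τ enskogRate` is small in local-Gibbs probability, `N → ∞` at fixed `r`, then
`r → 0`).  Second hypothesis: the body of `EnskogSidePreShock` (`contactPredM − σ³∫₀^τ enskogRate` small, same frame, `∀ k l`
before `∀ η δ`).  Conclusion: the body of `ContactEvenPreShock` (`collisionSum − contactPredM` small, same frame).  Union
bound pair by pair with thresholds `min η₀ / min σ₀ / min r₀ / max N₀`. [folklore] -/
theorem contactEvenPreShock_of_evenStressEnskogPreShock_of_enskogSidePreShock :
    (∃ η₀ : ℝ, 0 < η₀ ∧ ∀ (a₀ θ₀ : T3 → ℝ) (u₀ : T3 → V3), Continuous a₀ → Continuous θ₀ → Continuous u₀ →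
      (∀ x, 0 < a₀ x) → (∀ x, 0 < θ₀ x) → ∃ σ₀ : ℝ, 0 < σ₀ ∧ ∀ σ : ℝ, 0 < σ → σ < σ₀ →
      ∀ (T : ℝ) (ρ θ : ℝ → T3 → ℝ) (u : ℝ → T3 → V3), IsHardSphereEulerSolution σ T ρ u θ →
      ∀ Φ : (N : ℕ) → HardSphereFlow (Torus.geometry (Fin 3)) (hsDiameter σ N) (N + 1),
      TendstoHydroFieldsAt (fun N => localGibbsLaw σ a₀ u₀ θ₀ N (Φ N)) Φ ρ u θ 0 →
      ∀ τ : ℝ, 0 < τ → τ < T →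
      ∀ χ : ℝ × T3 → ℝ, Continuous χ → ∀ g : ℝ → ℝ, Continuous g → (∀ a, η₀ ≤ a → g a = 0) →
      ∀ η δ : ℝ, 0 < η → 0 < δ → ∃ r₀ : ℝ, 0 < r₀ ∧ ∀ r : ℝ, 0 < r → r < r₀ → ∃ N₀ : ℕ, ∀ N : ℕ, N₀ ≤ N →
      ∀ k l : Fin 3,
        localGibbsLaw σ a₀ u₀ θ₀ N (Φ N) {z | η < |evenStat σ N (Φ N) τ χ g (evenMark k l) r z|}
          ≤ ENNReal.ofReal δ) →
    (∃ η₀ : ℝ, 0 < η₀ ∧ ∀ (a₀ θ₀ : T3 → ℝ) (u₀ : T3 → V3), Continuous a₀ → Continuous θ₀ → Continuous u₀ →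
      (∀ x, 0 < a₀ x) → (∀ x, 0 < θ₀ x) → ∃ σ₀ : ℝ, 0 < σ₀ ∧ ∀ σ : ℝ, 0 < σ → σ < σ₀ →
      ∀ (T : ℝ) (ρ θ : ℝ → T3 → ℝ) (u : ℝ → T3 → V3), IsHardSphereEulerSolution σ T ρ u θ →
      ∀ Φ : (N : ℕ) → HardSphereFlow (Torus.geometry (Fin 3)) (hsDiameter σ N) (N + 1),
      TendstoHydroFieldsAt (fun N => localGibbsLaw σ a₀ u₀ θ₀ N (Φ N)) Φ ρ u θ 0 →
      ∀ τ : ℝ, 0 < τ → τ < T →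
      ∀ χ : ℝ × T3 → ℝ, Continuous χ → ∀ g : ℝ → ℝ, Continuous g → (∀ a, η₀ ≤ a → g a = 0) →
      ∀ k l : Fin 3,
      ∀ η δ : ℝ, 0 < η → 0 < δ → ∃ r₀ : ℝ, 0 < r₀ ∧ ∀ r : ℝ, 0 < r → r < r₀ → ∃ N₀ : ℕ, ∀ N : ℕ, N₀ ≤ N →
        localGibbsLaw σ a₀ u₀ θ₀ N (Φ N)
          {z | η < |contactPredM σ N (Φ N) τ χ g (evenMark k l) r z
                - σ ^ 3 * ∫ s in Set.Icc (0 : ℝ) τ, enskogRate σ N χ g (evenMark k l) r s ((Φ N).flow s z)|}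
          ≤ ENNReal.ofReal δ) →
    ∃ η₀ : ℝ, 0 < η₀ ∧ ∀ (a₀ θ₀ : T3 → ℝ) (u₀ : T3 → V3), Continuous a₀ → Continuous θ₀ → Continuous u₀ →
      (∀ x, 0 < a₀ x) → (∀ x, 0 < θ₀ x) → ∃ σ₀ : ℝ, 0 < σ₀ ∧ ∀ σ : ℝ, 0 < σ → σ < σ₀ →
      ∀ (T : ℝ) (ρ θ : ℝ → T3 → ℝ) (u : ℝ → T3 → V3), IsHardSphereEulerSolution σ T ρ u θ →
      ∀ Φ : (N : ℕ) → HardSphereFlow (Torus.geometry (Fin 3)) (hsDiameter σ N) (N + 1),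
      TendstoHydroFieldsAt (fun N => localGibbsLaw σ a₀ u₀ θ₀ N (Φ N)) Φ ρ u θ 0 →
      ∀ τ : ℝ, 0 < τ → τ < T →
      ∀ χ : ℝ × T3 → ℝ, Continuous χ → ∀ g : ℝ → ℝ, Continuous g → (∀ a, η₀ ≤ a → g a = 0) →
      ∀ k l : Fin 3,
      ∀ η δ : ℝ, 0 < η → 0 < δ → ∃ r₀ : ℝ, 0 < r₀ ∧ ∀ r : ℝ, 0 < r → r < r₀ → ∃ N₀ : ℕ, ∀ N : ℕ, N₀ ≤ N →
        localGibbsLaw σ a₀ u₀ θ₀ N (Φ N)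
          {z | η < |collisionSum σ N (Φ N) τ χ g (evenMark k l) r z - contactPredM σ N (Φ N) τ χ g (evenMark k l) r z|}
          ≤ ENNReal.ofReal δ := by
  intro hX hE
  obtain ⟨η₄, hη₄, H4⟩ := hX
  obtain ⟨η₅, hη₅, H5⟩ := hE
  refine ⟨min η₄ η₅, lt_min hη₄ hη₅, ?_⟩
  intro a₀ θ₀ u₀ ha hθ hu ha0 hθ0
  obtain ⟨σ₄, hσ₄, H4⟩ := H4 a₀ θ₀ u₀ ha hθ hu ha0 hθ0
  obtain ⟨σ₅, hσ₅, H5⟩ := H5 a₀ θ₀ u₀ ha hθ hu ha0 hθ0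
  refine ⟨min σ₄ σ₅, lt_min hσ₄ hσ₅, ?_⟩
  intro σ hσ hσlt T ρ θ u hEul Φ hLLN τ hτ hτT χ hχ g hg hg0 k l η δ hη hδ
  have hσ4 : σ < σ₄ := lt_of_lt_of_le hσlt (min_le_left _ _)
  have hσ5 : σ < σ₅ := lt_of_lt_of_le hσlt (min_le_right _ _)
  have hg4 : ∀ a, η₄ ≤ a → g a = 0 := fun a h => hg0 a ((min_le_left _ _).trans h)
  have hg5 : ∀ a, η₅ ≤ a → g a = 0 := fun a h => hg0 a ((min_le_right _ _).trans h)
  have hη2 : 0 < η / 2 := by positivity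
  have hδ2 : 0 < δ / 2 := by positivity
  obtain ⟨r₄, hr₄, H4'⟩ := H4 σ hσ hσ4 T ρ θ u hEul Φ hLLN τ hτ hτT χ hχ g hg hg4 (η / 2) (δ / 2) hη2 hδ2
  obtain ⟨r₅, hr₅, H5'⟩ := H5 σ hσ hσ5 T ρ θ u hEul Φ hLLN τ hτ hτT χ hχ g hg hg5 k l (η / 2) (δ / 2) hη2 hδ2
  refine ⟨min r₄ r₅, lt_min hr₄ hr₅, fun r hr hrlt => ?_⟩
  have hr4 : r < r₄ := lt_of_lt_of_le hrlt (min_le_left _ _)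
  have hr5 : r < r₅ := lt_of_lt_of_le hrlt (min_le_right _ _)
  obtain ⟨N₄, H4''⟩ := H4' r hr hr4
  obtain ⟨N₅, H5''⟩ := H5' r hr hr5
  refine ⟨max N₄ N₅, fun N hN => ?_⟩
  have E4 := H4'' N ((le_max_left _ _).trans hN) k l
  have E5 := H5'' N ((le_max_right _ _).trans hN)
  set P := localGibbsLaw σ a₀ u₀ θ₀ N (Φ N)
  set K := fun z => collisionSum σ N (Φ N) τ χ g (evenMark k l) r z
  set C := fun z => contactPredM σ N (Φ N) τ χ g (evenMark k l) r z
  set E := fun z => σ ^ 3 * ∫ s in Set.Icc (0 : ℝ) τ, enskogRate σ N χ g (evenMark k l) r s ((Φ N).flow s z)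
  have hD : ∀ z, evenStat σ N (Φ N) τ χ g (evenMark k l) r z = K z - E z := fun z => rfl
  have hsub : {z | η < |K z - C z|}
      ⊆ {z | η / 2 < |evenStat σ N (Φ N) τ χ g (evenMark k l) r z|} ∪ {z | η / 2 < |C z - E z|} := by
    intro z hz
    simp only [Set.mem_setOf_eq, Set.mem_union] at hz ⊢
    rw [hD z]
    by_contra hcon
    simp only [not_or, not_lt] at hcon
    obtain ⟨h1', h2'⟩ := hcon
    have : |K z - C z| ≤ |K z - E z| + |E z - C z| := abs_sub_le (K z) (E z) (C z)
    rw [abs_sub_comm (E z) (C z)] at this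
    linarith
  calc P {z | η < |K z - C z|}
      ≤ P ({z | η / 2 < |evenStat σ N (Φ N) τ χ g (evenMark k l) r z|} ∪ {z | η / 2 < |C z - E z|}) :=
        measure_mono hsub
    _ ≤ P {z | η / 2 < |evenStat σ N (Φ N) τ χ g (evenMark k l) r z|} + P {z | η / 2 < |C z - E z|} :=
        measure_union_le _ _
    _ ≤ ENNReal.ofReal (δ / 2) + ENNReal.ofReal (δ / 2) := add_le_add E4 E5
    _ = ENNReal.ofReal δ := by
        rw [← ENNReal.ofReal_add hδ2.le hδ2.le]
        congr 1
        ring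

end Summit.AtomisticToContinuum.HydrodynamicLimit.Theorems.EvenStressEnskog

end
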